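import Summits.QuantumFields.YangMills.Theorems.SwapVirialDeficitSectorLaplaceEndGaussShellPoint
import Summits.QuantumFields.YangMills.Theorems.SwapVirialDeficitSectorLaplaceEndGaussCoreRate
import Summits.QuantumFields.YangMills.Theorems.SwapVirialDeficitSectorLaplaceBulkMassFloor
import HarnessLib

/-!
# STUB (S-end-G♭) OF SKELETON ➎, SHELL SIDE (δ), INTEGRATED: the reference one-loop weight of the base plane is paid for by the adjacent bulk shell
# (free-hands support of ⟨stmt-QuantumFields-24197⟩ `SwapVirialDeficit.SwapGluedStiffness`; cell ym-idea-1, LEAD g99 22:59Z ruling (δ), memo11 §2; assembler fcl-p3 g48)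

★★★ `endGauss_shell_ge (hε) (hAs′) (hamb′) (hray′) (hr0) (hr1) (hr)`: for good signs, a reference follower-Hessian family `A′` at the end hub `hubAt 0 1` and a matching
radius `0 < r ≤ 1` with `122689728·r·L⁴ ≤ μ_F∕2`:
`∫⁻ p, ofReal((1+x₀²)⁻¹(1+y₀²)⁻¹ ∕ √det A′(gnoBase p)) ≤ ofReal(C_F · 8∕r) · ofReal(∫_{δ′ ∈ Icc (r∕2) r} ((1+δ′²)⁻¹)² · ∫_p 𝔪(hubAt δ′ 1, ε, p))`,
`C_F = ((1+d)·20400L⁴)^{7∕2} · e^{½} · e^{3|Fol L|·122689728·r·L⁴∕μ_F}` — b-FREE.  Pointwise ✓`mbDensity_shell_ge_ref` at every shell hub, the plane mass is a Bochner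
integral of an integrable function (✓`integrable_planeMass_of_hubBulk` at `τ = δ′²∕2`), then the shell weight `∫_{Icc(r∕2) r} ((1+δ′²)⁻¹)² ≥ r∕8` (✓`endShell_weight_ge`).
The right side is what ✓`mbMain_ge_of_subset` ∕ ✓`gaussCore_target_of_shell` turn into `(2π∕b)^α M_ε` (`Icc (r∕2) r ⊆` shell window by ✓`Icc_subset_endShell`, `τ ≤ r²∕4`).

HONEST LABEL: the shell side (δ) of `stub_end_gaussCore` only; N2, the slab∕shell comparison and the assembly, `stub_core_tip`, hence ⟨24197⟩ ∕ ⟨24194⟩ remain OPEN; item of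
record ⟨24085⟩ SubOctaveBounded aside ∕ untouched; the Yang–Mills mass gap is NOT proved; no summit is proved by a line.  THEOREMS ONLY (0 `def`, 0 `sorry`), standard axioms,
no instances.  Seat ym-line-fcl-p3 g48 (cell ym-idea-1, free hands), `--supports stmt-QuantumFields-24197`.  References: [cite: Luscher1983, §2]; [cite: Breitung1994, Lemma 26]; [folklore].
-/

set_option autoImplicit false
set_option synthInstance.maxSize 1024

noncomputable section

open MeasureTheory Quaternion Set Module
open scoped Quaternion BigOperators ENNReal InnerProductSpace
open Literature.MathematicalPhysics.QuantumLattice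
open Literature.MathematicalPhysics.QuantumFieldTheory hiding SU2

namespace Summit.QuantumFields.YangMills.Theorems.SwapVirialDeficit.SectorLaplace

open Summit.QuantumFields.YangMills.Theorems.FemtoTransferGap
open Summit.QuantumFields.YangMills.Theorems.FemtoTransferGap.TT
open Summit.QuantumFields.YangMills.Theorems.VirialFluxGap.RingDeficit
open Summit.QuantumFields.YangMills.Theorems.SwapVirialDeficit.SwapRing
open Summit.QuantumFields.YangMills.Theorems.SwapVirialDeficit.BlowUpRing

variable {L : ℕ} [NeZero L]

/-- A shell hub `hubAt δ′ 1`, `0 < δ′ ≤ 1`, is a bulk hub at the cut `δ′²∕2` — so its plane mass is a Bochner integral of an integrable function. [folklore] -/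
theorem integrable_planeMass_shellHub {ε : GnoSign L} (hε : GoodSign ε) {δ' : ℝ} (hδ0 : 0 < δ') (hδ1 : δ' ≤ 1) :
    Integrable (fun p : ℝ × ℝ => mbDensity (L := L) (hubAt δ' 1) ε p) := by
  have him : (hubAt δ' 1).im ≠ 0 := hubAt_one_im_ne_zero δ'
  have hcot : (hubAt δ' 1).re / ‖(hubAt δ' 1).im‖ = δ' := by rw [norm_im_hubAt_one, hubAt_one_re, div_one]
  have hδsq : δ' ^ 2 ≤ 1 := by nlinarith
  have hmem : hubAt δ' 1 ∈ HubBulk (δ' ^ 2 / 2) := by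
    rw [mem_hubBulk_iff_cot him, hcot]
    constructor
    · rw [div_le_div_iff₀ (by norm_num) (by positivity)]
      have h4 : (1 + δ' ^ 2) ^ 2 ≤ 4 := by nlinarith
      have h5 : 0 ≤ δ' ^ 2 := sq_nonneg _
      nlinarith [mul_le_mul_of_nonneg_left h4 h5]
    · rw [le_inv_comm₀ (by positivity) (by positivity)]
      have : (δ' ^ 2 / 2)⁻¹ = 2 / δ' ^ 2 := by rw [inv_div]
      rw [this, le_div_iff₀ (by positivity)]; nlinarith
  exact integrable_planeMass_of_hubBulk hε (by positivity) (by nlinarith) hmem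

set_option maxHeartbeats 800000 in
/-- ★★★ **THE SHELL SIDE (δ) OF `stub_end_gaussCore`** — see the module docstring. [cite: Luscher1983, §2] [cite: Breitung1994, Lemma 26] -/
theorem endGauss_shell_ge {ε : GnoSign L} (hε : GoodSign ε)
    {A' : GnoCoord L → GnoFol L →ₗ[ℝ] GnoFol L} (hAs' : ∀ η, (A' η).IsSymmetric)
    (hamb' : ∀ η (y : GnoFol L), ⟪A' η y, y⟫_ℝ = iteratedFDeriv ℝ 2 (gnoDeficit (fun _ => false) (fun _ => 1) (hubAt 0 1) ε) η (fun _ => gnoFolEmb y))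
    (hray' : ∀ η' (y : GnoFol L), ⟪A' η' y, y⟫_ℝ = iteratedDeriv 2 (fun s : ℝ => gnoDeficit (fun _ => false) (fun _ => 1) (hubAt 0 1) ε (η' + s • gnoFolEmb y)) 0)
    {r : ℝ} (hr0 : 0 < r) (hr1 : r ≤ 1) (hr : 122689728 * r * (L : ℝ) ^ 4 ≤ (2304 * (L : ℝ) ^ 6 * (Fintype.card (Fol L) : ℝ))⁻¹ / 2) :
    ∫⁻ p : ℝ × ℝ, ENNReal.ofReal ((1 + p.1 ^ 2)⁻¹ * (1 + p.2 ^ 2)⁻¹ / Real.sqrt (LinearMap.det (A' (gnoBase p.1 p.2)))) ≤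
      ENNReal.ofReal ((((1 + (finrank ℝ (GnoFol L) : ℝ)) * (20400 * (L : ℝ) ^ 4)) ^ (7 / 2 : ℝ) * Real.exp (1 / 2 : ℝ) *
          Real.exp ((3 * (Fintype.card (Fol L) : ℝ)) * (122689728 * r * (L : ℝ) ^ 4) / (2304 * (L : ℝ) ^ 6 * (Fintype.card (Fol L) : ℝ))⁻¹)) * (8 / r)) *
        ENNReal.ofReal (∫ δ' in Icc (r / 2) r, ((1 + δ' ^ 2)⁻¹) ^ 2 * ∫ p : ℝ × ℝ, mbDensity (L := L) (hubAt δ' 1) ε p) := by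
  have hL : (0 : ℝ) < L := by exact_mod_cast NeZero.pos L
  -- the pointwise constant `c` and its inverse `C_F`
  set c : ℝ := ((1 + (finrank ℝ (GnoFol L) : ℝ)) * (20400 * (L : ℝ) ^ 4)) ^ (-(7 / 2 : ℝ)) * Real.exp (-(1 / 2 : ℝ)) *
    Real.exp (-((3 * (Fintype.card (Fol L) : ℝ)) * (122689728 * r * (L : ℝ) ^ 4) / (2304 * (L : ℝ) ^ 6 * (Fintype.card (Fol L) : ℝ))⁻¹)) with hc
  set C : ℝ := ((1 + (finrank ℝ (GnoFol L) : ℝ)) * (20400 * (L : ℝ) ^ 4)) ^ (7 / 2 : ℝ) * Real.exp (1 / 2 : ℝ) *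
    Real.exp ((3 * (Fintype.card (Fol L) : ℝ)) * (122689728 * r * (L : ℝ) ^ 4) / (2304 * (L : ℝ) ^ 6 * (Fintype.card (Fol L) : ℝ))⁻¹) with hC
  have hc0 : 0 < c := by positivity
  have hC0 : 0 < C := by positivity
  have hcC : c * C = 1 := by
    rw [hc, hC]
    have h1 : ((1 + (finrank ℝ (GnoFol L) : ℝ)) * (20400 * (L : ℝ) ^ 4)) ^ (-(7 / 2 : ℝ)) * ((1 + (finrank ℝ (GnoFol L) : ℝ)) * (20400 * (L : ℝ) ^ 4)) ^ (7 / 2 : ℝ) = 1 := by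
      rw [← Real.rpow_add (by positivity), neg_add_cancel, Real.rpow_zero]
    have h2 : Real.exp (-(1 / 2 : ℝ)) * Real.exp (1 / 2 : ℝ) = 1 := by rw [← Real.exp_add, neg_add_cancel, Real.exp_zero]
    have h3 : Real.exp (-((3 * (Fintype.card (Fol L) : ℝ)) * (122689728 * r * (L : ℝ) ^ 4) / (2304 * (L : ℝ) ^ 6 * (Fintype.card (Fol L) : ℝ))⁻¹)) *
        Real.exp ((3 * (Fintype.card (Fol L) : ℝ)) * (122689728 * r * (L : ℝ) ^ 4) / (2304 * (L : ℝ) ^ 6 * (Fintype.card (Fol L) : ℝ))⁻¹) = 1 := by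
      rw [← Real.exp_add, neg_add_cancel, Real.exp_zero]
    calc _ = (((1 + (finrank ℝ (GnoFol L) : ℝ)) * (20400 * (L : ℝ) ^ 4)) ^ (-(7 / 2 : ℝ)) * ((1 + (finrank ℝ (GnoFol L) : ℝ)) * (20400 * (L : ℝ) ^ 4)) ^ (7 / 2 : ℝ)) *
        (Real.exp (-(1 / 2 : ℝ)) * Real.exp (1 / 2 : ℝ)) *
        (Real.exp (-((3 * (Fintype.card (Fol L) : ℝ)) * (122689728 * r * (L : ℝ) ^ 4) / (2304 * (L : ℝ) ^ 6 * (Fintype.card (Fol L) : ℝ))⁻¹)) *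
          Real.exp ((3 * (Fintype.card (Fol L) : ℝ)) * (122689728 * r * (L : ℝ) ^ 4) / (2304 * (L : ℝ) ^ 6 * (Fintype.card (Fol L) : ℝ))⁻¹)) := by ring
      _ = 1 := by rw [h1, h2, h3]; ring
  -- names
  set w : ℝ × ℝ → ℝ := fun p => (1 + p.1 ^ 2)⁻¹ * (1 + p.2 ^ 2)⁻¹ / Real.sqrt (LinearMap.det (A' (gnoBase p.1 p.2))) with hw
  set X : ℝ≥0∞ := ∫⁻ p : ℝ × ℝ, ENNReal.ofReal (w p) with hX
  set I : ℝ → ℝ := fun δ' => ∫ p : ℝ × ℝ, mbDensity (L := L) (hubAt δ' 1) ε p with hI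
  have hI0 : ∀ δ', 0 ≤ I δ' := fun δ' => integral_nonneg fun p => mbDensity_nonneg _ ε p
  -- (i) for every shell hub: `c·X ≤ I(δ′)` in `ℝ≥0∞`
  have hXI : ∀ δ' ∈ Icc (r / 2) r, X ≤ ENNReal.ofReal (c⁻¹ * I δ') := by
    intro δ' hδ'
    have hδ0 : 0 < δ' := by linarith [hδ'.1]
    have hpt : ∀ p : ℝ × ℝ, w p ≤ c⁻¹ * mbDensity (L := L) (hubAt δ' 1) ε p := by
      intro p
      have h := mbDensity_shell_ge_ref (L := L) hε hAs' hamb' hray' hδ0 hδ'.2 hr p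
      rw [le_inv_mul_iff₀ hc0]
      calc c * w p = (1 + p.1 ^ 2)⁻¹ * (1 + p.2 ^ 2)⁻¹ * (c / Real.sqrt (LinearMap.det (A' (gnoBase p.1 p.2)))) := by rw [hw]; ring
        _ ≤ mbDensity (L := L) (hubAt δ' 1) ε p := by rw [hc]; exact h
    have hint := integrable_planeMass_shellHub (L := L) hε hδ0 (hδ'.2.trans hr1)
    calc X ≤ ∫⁻ p : ℝ × ℝ, ENNReal.ofReal (c⁻¹ * mbDensity (L := L) (hubAt δ' 1) ε p) := lintegral_mono fun p => ENNReal.ofReal_le_ofReal (hpt p)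
      _ = ENNReal.ofReal (∫ p : ℝ × ℝ, c⁻¹ * mbDensity (L := L) (hubAt δ' 1) ε p) := by
          rw [ofReal_integral_eq_lintegral_ofReal (hint.const_mul _) (Filter.Eventually.of_forall fun p => mul_nonneg (inv_nonneg.2 hc0.le) (mbDensity_nonneg _ ε p))]
      _ = ENNReal.ofReal (c⁻¹ * I δ') := by rw [integral_const_mul]
  -- (ii) `X` is finite; pass to reals
  have hXfin : X ≠ ⊤ := by
    have h := hXI r ⟨by linarith, le_rfl⟩
    exact ne_top_of_le_ne_top ENNReal.ofReal_ne_top h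
  set x : ℝ := X.toReal with hx
  have hXx : X = ENNReal.ofReal x := by rw [hx, ENNReal.ofReal_toReal hXfin]
  have hx0 : 0 ≤ x := ENNReal.toReal_nonneg
  have hxI : ∀ δ' ∈ Icc (r / 2) r, c * x ≤ I δ' := by
    intro δ' hδ'
    have h := hXI δ' hδ'
    rw [hXx] at h
    have h' := (ENNReal.ofReal_le_ofReal_iff (mul_nonneg (inv_nonneg.2 hc0.le) (hI0 δ'))).1 h
    calc c * x ≤ c * (c⁻¹ * I δ') := mul_le_mul_of_nonneg_left h' hc0.le
      _ = I δ' := by rw [← mul_assoc, mul_inv_cancel₀ hc0.ne', one_mul]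
  -- (iii) integrate over the shell with the weight `((1+δ′²)⁻¹)²`
  have hsub : Icc (r / 2) r ⊆ {δ : ℝ | r ^ 2 / 4 ≤ 4 * δ ^ 2 / (1 + δ ^ 2) ^ 2 ∧ r ^ 2 / 4 ≤ (1 + δ ^ 2)⁻¹} :=
    (Icc_subset_endShell hr0 hr1 le_rfl).trans (endShell_subset_bulkWindow (by nlinarith) hr1)
  have hintI : IntegrableOn (fun δ' : ℝ => ((1 + δ' ^ 2)⁻¹) ^ 2 * I δ') (Icc (r / 2) r) :=
    (integrableOn_planeMass_hubCot (L := L) hε (by positivity) (by nlinarith) ).mono_set hsub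
  have hwt := endShell_weight_ge hr0.le hr1
  have hcmp : ∫ δ' in Icc (r / 2) r, ((1 + δ' ^ 2)⁻¹) ^ 2 * (c * x) ≤ ∫ δ' in Icc (r / 2) r, ((1 + δ' ^ 2)⁻¹) ^ 2 * I δ' := by
    refine setIntegral_mono_on ?_ hintI measurableSet_Icc fun δ' hδ' => mul_le_mul_of_nonneg_left (hxI δ' hδ') (by positivity)
    have hcont : Continuous fun δ' : ℝ => ((1 + δ' ^ 2)⁻¹) ^ 2 * (c * x) :=
      (((continuous_const.add (continuous_id.pow 2)).inv₀ fun δ' => (by positivity : (0 : ℝ) < 1 + δ' ^ 2).ne').pow 2).mul continuous_const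
    exact hcont.integrableOn_Icc
  rw [integral_mul_const] at hcmp
  -- `(r∕8)·c·x ≤ ∫ wδ I`, hence `x ≤ C·(8∕r)·∫ wδ I`
  have hkey : x ≤ C * (8 / r) * ∫ δ' in Icc (r / 2) r, ((1 + δ' ^ 2)⁻¹) ^ 2 * I δ' := by
    have h1 : r / 8 * (c * x) ≤ ∫ δ' in Icc (r / 2) r, ((1 + δ' ^ 2)⁻¹) ^ 2 * I δ' :=
      le_trans (mul_le_mul_of_nonneg_right hwt (by positivity)) hcmp
    have h2 : x = C * (8 / r) * (r / 8 * (c * x)) := by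
      field_simp
      nlinarith [hcC]
    rw [h2]
    exact mul_le_mul_of_nonneg_left h1 (by positivity)
  rw [hXx]
  calc ENNReal.ofReal x ≤ ENNReal.ofReal (C * (8 / r) * ∫ δ' in Icc (r / 2) r, ((1 + δ' ^ 2)⁻¹) ^ 2 * I δ') := ENNReal.ofReal_le_ofReal hkey
    _ = ENNReal.ofReal (C * (8 / r)) * ENNReal.ofReal (∫ δ' in Icc (r / 2) r, ((1 + δ' ^ 2)⁻¹) ^ 2 * I δ') := by
        rw [ENNReal.ofReal_mul (by positivity)]

end Summit.QuantumFields.YangMills.Theorems.SwapVirialDeficit.SectorLaplace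

end
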